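import Summits.Schanuel.Schanuel.Theses.RoyCriterion

/-!
# `RoySmallValueDirichletGap`: every slice `τ < 1` and every derivative count `≤ D` is false
(negative lemmas for crux `stmt-Schanuel-1050`)

Load-bearing analysis of `Summit.Schanuel.Schanuel.Theses.RoyCriterion.RoySmallValueDirichletGap`
(Roy 2013, Mathematika 59 = arXiv:1301.0663, Theorem 1.1 pushed to the Dirichlet edge), by EXACT
`𝒟₁`-vanishing witnesses at the transcendental point `(e, 1)`:

* `𝒟₁ⁱ (X₂ − 1)ⁿ ∈ (X₂ − 1)^{n−i} ℤ[X₁, X₂]` (`pow_dvd_iterate_royD`), so `P = (X₂ − 1)ⁿ` (degree `n`,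
  height `≤ 2ⁿ`) has `𝒟₁ⁱP(ξ, 1) = 0` for all `i < n`, at EVERY `ξ`;
* hence the small-value hypothesis holds at `(e, 1)` for every count function `c(D)` that is
  eventually `≤ D` with `c(D) log 2 ≤ D^β` (`hyp_at_e_one_of_count_le`);
* consequences: (1) for EVERY `τ < 1`, `β > τ` and every `ν` the crux-shaped implication is false
  (`roySmallValueDirichletGap_slice_false_of_tau_lt_one`) — an elementary substitute for the
  Khintchine–Philippon points by which Roy shows that `τ ≥ 1` is necessary (Roy 2013, p. 4); so the
  hypothesis `1 ≤ τ` of the crux is load-bearing (`roySmallValueDirichletGap_false_without_oneLeTau`);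
  (2) the natural STRENGTHENING of the crux in which Roy's count `3⌊D^τ⌋` is replaced by any count
  eventually `≤ D` at some admissible `τ₀ ∈ [1,2)` is false
  (`roySmallValueDirichletGap_false_of_count_le_degree`), e.g. the unit count `⌊D^τ⌋`
  (`roySmallValueDirichletGap_false_with_unitCount`).

The mechanism stops exactly at order `D = deg P`: at a point with a transcendental coordinate the
Taylor coefficients of `z ↦ P(ξ + z, η e^z)` are rational polynomials in that coordinate, so exact
vanishing is an identity in it, and after `w = ξ + z` the function `∑ₖ pₖ(w) ηᵏ e^{kz}` has at most
`D + 1` frequencies; Roy's factor `3` is what puts the crux out of reach of such witnesses for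
`τ ≥ 1`. Everything is proved; no definitions, no named facts.
-/

noncomputable section

namespace Summit.Schanuel.Schanuel.Theorems.RoySmallValueDirichletGapTauCount

open MvPolynomial Filter Complex
open Literature.NumberTheory.Transcendental

/-! ### `𝒟₁` on `(X₂ − 1)ⁿ` -/

/-- `𝒟₁` is `ℤ`-linear: subtraction. [folklore] -/
theorem royD_sub (P Q : MvPolynomial (Fin 2) ℤ) : royD (P - Q) = royD P - royD Q := by
  simp only [royD, map_sub]; ring

/-- `𝒟₁ (X₂ − 1) = X₂`. [cite: Roy2013, §1 (𝒟₁ = ∂/∂X₁ + X₂∂/∂X₂)] -/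
theorem royD_X_one_sub_one : royD (X 1 - 1 : MvPolynomial (Fin 2) ℤ) = X 1 := by
  rw [royD_sub, royD_X_one, show (1 : MvPolynomial (Fin 2) ℤ) = C 1 from rfl, royD_C, sub_zero]

/-- Power rule for the derivation `𝒟₁`. [folklore] -/
theorem royD_pow_succ (P : MvPolynomial (Fin 2) ℤ) (n : ℕ) :
    royD (P ^ (n + 1)) = C ((n : ℤ) + 1) * P ^ n * royD P := by
  induction n with
  | zero => simp
  | succ n ih =>
    rw [pow_succ, royD_mul, ih]
    simp only [map_add, map_one, pow_succ, Nat.cast_succ, map_natCast]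
    ring

/-- `(X₂ − 1)^{n−i} ∣ 𝒟₁ⁱ ((X₂ − 1)ⁿ R)` for `i ≤ n`. [folklore] -/
theorem pow_dvd_iterate_royD (i : ℕ) : ∀ (n : ℕ) (R : MvPolynomial (Fin 2) ℤ), i ≤ n →
    (X 1 - 1) ^ (n - i) ∣ royD^[i] ((X 1 - 1) ^ n * R) := by
  induction i with
  | zero => intro n R _; exact ⟨R, by simp⟩
  | succ i ih =>
    intro n R hin
    obtain ⟨m, rfl⟩ : ∃ m, n = m + 1 := ⟨n - 1, by omega⟩
    rw [Function.iterate_succ_apply, royD_mul, royD_pow_succ, royD_X_one_sub_one]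
    have hrw : C ((m : ℤ) + 1) * (X 1 - 1) ^ m * X 1 * R + (X 1 - 1) ^ (m + 1) * royD R =
        (X 1 - 1) ^ m * (C ((m : ℤ) + 1) * X 1 * R + (X 1 - 1) * royD R) := by ring
    rw [hrw, show m + 1 - (i + 1) = m - i by omega]
    exact ih m _ (by omega)

/-- `𝒟₁ⁱ (X₂ − 1)ⁿ` vanishes at `(ξ, 1)` for `i < n`. [folklore] -/
theorem aeval_iterate_royD_pow_eq_zero (ξ : ℂ) {i n : ℕ} (hin : i < n) :
    aeval ![ξ, 1] (royD^[i] ((X 1 - 1 : MvPolynomial (Fin 2) ℤ) ^ n)) = 0 := by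
  obtain ⟨S, hS⟩ := pow_dvd_iterate_royD i n 1 hin.le
  rw [mul_one] at hS
  rw [hS, map_mul, map_pow]
  have h0 : aeval ![ξ, (1 : ℂ)] (X 1 - 1 : MvPolynomial (Fin 2) ℤ) = 0 := by simp
  rw [h0, zero_pow (by omega), zero_mul]

/-- `X₂ − 1 ≠ 0`. [folklore] -/
theorem X_one_sub_one_ne_zero : (X 1 - 1 : MvPolynomial (Fin 2) ℤ) ≠ 0 := by
  intro h
  have := congrArg (MvPolynomial.eval (0 : Fin 2 → ℤ)) h
  simp at this

/-- `deg (X₂ − 1)ⁿ ≤ n`. [folklore] -/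
theorem totalDegree_pow_X_one_sub_one_le (n : ℕ) :
    ((X 1 - 1 : MvPolynomial (Fin 2) ℤ) ^ n).totalDegree ≤ n := by
  refine (totalDegree_pow _ _).trans ?_
  have h : (X 1 - 1 : MvPolynomial (Fin 2) ℤ).totalDegree ≤ 1 := by
    refine (totalDegree_sub _ _).trans ?_
    simp [totalDegree_X]
  calc n * (X 1 - 1 : MvPolynomial (Fin 2) ℤ).totalDegree ≤ n * 1 := Nat.mul_le_mul_left n h
    _ = n := mul_one n

/-- Height of `(X₂ − 1)ⁿ` is at most `2ⁿ` (sum of the binomial coefficients). [folklore] -/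
theorem mvPolyHeight_pow_X_one_sub_one_le (n : ℕ) :
    mvPolyHeight ((X 1 - 1 : MvPolynomial (Fin 2) ℤ) ^ n) ≤ 2 ^ n := by
  refine Finset.sup_le fun m _ => ?_
  have hexp : (X 1 - 1 : MvPolynomial (Fin 2) ℤ) ^ n =
      ∑ k ∈ Finset.range (n + 1), monomial (Finsupp.single 1 k) ((-1) ^ (n - k) * (n.choose k : ℤ)) := by
    rw [sub_eq_add_neg, add_pow]
    refine Finset.sum_congr rfl fun k _ => ?_
    rw [← C_mul_X_pow_eq_monomial, map_mul, map_pow, map_neg, map_one, map_natCast]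
    ring
  show ((X 1 - 1 : MvPolynomial (Fin 2) ℤ) ^ n |>.coeff m).natAbs ≤ 2 ^ n
  rw [hexp, coeff_sum, ← Nat.sum_range_choose n]
  refine (Int.natAbs_sum_le _ _).trans (Finset.sum_le_sum fun k _ => ?_)
  rw [coeff_monomial]
  split_ifs
  · simp [Int.natAbs_mul, Int.natAbs_pow]
  · simp

/-! ### Eventual inequalities -/

/-- `C·D^a ≤ D^b` eventually in `D : ℕ`, for `a < b`. [folklore] -/
theorem eventually_nat_mul_rpow_le_rpow (C : ℝ) {a b : ℝ} (hab : a < b) :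
    ∀ᶠ D : ℕ in atTop, C * (D : ℝ) ^ a ≤ (D : ℝ) ^ b := by
  have h := eventually_mul_rpow_le_mul_rpow C hab one_pos
  simp only [one_mul] at h
  exact tendsto_natCast_atTop_atTop.eventually h

/-- For `τ < 1`: `3⌊D^τ⌋ ≤ D` eventually. [folklore] -/
theorem eventually_count_le_self {τ : ℝ} (hτ : τ < 1) : ∀ᶠ D : ℕ in atTop, 3 * ⌊(D : ℝ) ^ τ⌋₊ ≤ D := by
  filter_upwards [eventually_nat_mul_rpow_le_rpow 3 hτ] with D hD
  have h0 : (0 : ℝ) ≤ (D : ℝ) ^ τ := Real.rpow_nonneg (Nat.cast_nonneg D) τ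
  have h1 : ((3 * ⌊(D : ℝ) ^ τ⌋₊ : ℕ) : ℝ) ≤ D := by
    push_cast
    calc (3 : ℝ) * ⌊(D : ℝ) ^ τ⌋₊ ≤ 3 * (D : ℝ) ^ τ := by gcongr; exact Nat.floor_le h0
      _ ≤ (D : ℝ) ^ (1 : ℝ) := hD
      _ = D := Real.rpow_one _
  exact_mod_cast h1

/-- For `τ < β`: `3⌊D^τ⌋ · log 2 ≤ D^β` eventually. [folklore] -/
theorem eventually_count_log_two_le {τ β : ℝ} (hτβ : τ < β) :
    ∀ᶠ D : ℕ in atTop, ((3 * ⌊(D : ℝ) ^ τ⌋₊ : ℕ) : ℝ) * Real.log 2 ≤ (D : ℝ) ^ β := by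
  filter_upwards [eventually_nat_mul_rpow_le_rpow (3 * Real.log 2) hτβ] with D hD
  have h0 : (0 : ℝ) ≤ (D : ℝ) ^ τ := Real.rpow_nonneg (Nat.cast_nonneg D) τ
  have hl : 0 ≤ Real.log 2 := Real.log_nonneg one_le_two
  push_cast
  calc 3 * (⌊(D : ℝ) ^ τ⌋₊ : ℝ) * Real.log 2 ≤ 3 * (D : ℝ) ^ τ * Real.log 2 := by
        gcongr; exact Nat.floor_le h0
    _ = 3 * Real.log 2 * (D : ℝ) ^ τ := by ring
    _ ≤ (D : ℝ) ^ β := hD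

/-- For `1 ≤ β`: `D · log 2 ≤ D^β` eventually. [folklore] -/
theorem eventually_self_log_two_le {β : ℝ} (hβ : 1 ≤ β) :
    ∀ᶠ D : ℕ in atTop, (D : ℝ) * Real.log 2 ≤ (D : ℝ) ^ β := by
  filter_upwards [eventually_ge_atTop 1] with D hD
  have h1 : (1 : ℝ) ≤ D := by exact_mod_cast hD
  have hl : Real.log 2 ≤ 1 := by have := Real.log_two_lt_d9; linarith
  calc (D : ℝ) * Real.log 2 ≤ (D : ℝ) * 1 := by gcongr
    _ = (D : ℝ) ^ (1 : ℝ) := by simp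
    _ ≤ (D : ℝ) ^ β := Real.rpow_le_rpow_of_exponent_le h1 hβ

/-! ### The witness at `(ξ, 1)` -/

/-- **Witness family**: at ANY point `(ξ, 1)`, for any `ν` and any count function `c` eventually
`≤ D` with `c(D) log 2 ≤ D^β`, the small-value hypothesis (with count `c`) holds with
`P_D = (X₂ − 1)^{c(D)}` and EXACT zeros. [folklore] -/
theorem hyp_at_one_of_count_le (ξ : ℂ) (c : ℕ → ℕ) (β ν : ℝ)
    (hdeg : ∀ᶠ D in atTop, c D ≤ D) (hht : ∀ᶠ D : ℕ in atTop, (c D : ℝ) * Real.log 2 ≤ (D : ℝ) ^ β) :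
    ∀ᶠ D : ℕ in atTop, ∃ P : MvPolynomial (Fin 2) ℤ, P ≠ 0 ∧ P.totalDegree ≤ D ∧
      (mvPolyHeight P : ℝ) ≤ Real.exp ((D : ℝ) ^ β) ∧
      ∀ i : ℕ, i < c D → ‖aeval ![ξ, (1 : ℂ)] (royD^[i] P)‖ ≤ Real.exp (-(D : ℝ) ^ ν) := by
  filter_upwards [hdeg, hht] with D h1 h2
  refine ⟨(X 1 - 1) ^ c D, pow_ne_zero _ X_one_sub_one_ne_zero,
    (totalDegree_pow_X_one_sub_one_le _).trans h1, ?_, fun i hi => ?_⟩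
  · calc ((mvPolyHeight ((X 1 - 1 : MvPolynomial (Fin 2) ℤ) ^ c D) : ℕ) : ℝ) ≤ ((2 ^ c D : ℕ) : ℝ) := by
          exact_mod_cast mvPolyHeight_pow_X_one_sub_one_le (c D)
      _ = Real.exp ((c D : ℝ) * Real.log 2) := by
          rw [Real.exp_nat_mul, Real.exp_log two_pos]; push_cast; ring
      _ ≤ Real.exp ((D : ℝ) ^ β) := Real.exp_le_exp.2 h2
  · rw [aeval_iterate_royD_pow_eq_zero ξ hi, norm_zero]
    exact (Real.exp_pos _).le

/-! ### Consequences -/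

/-- **Every slice `τ < 1` (`β > τ`, any `ν`) of the crux-shaped implication is FALSE** at the point
`(e, 1)` (`P_D = (X₂ − 1)^{3⌊D^τ⌋}`, exact zeros; `e` transcendental by Hermite, in tree).
[cite: Roy2013, p. 4 ("the restriction τ ≥ 1 is crucial")] -/
theorem roySmallValueDirichletGap_slice_false_of_tau_lt_one {τ β : ℝ} (hτ : τ < 1) (hτβ : τ < β)
    (ν : ℝ) :
    ¬ (∀ (ξ η : ℂ), η ≠ 0 →
      (∀ᶠ D : ℕ in Filter.atTop, ∃ P : MvPolynomial (Fin 2) ℤ, P ≠ 0 ∧ P.totalDegree ≤ D ∧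
        (mvPolyHeight P : ℝ) ≤ Real.exp ((D : ℝ) ^ β) ∧
        ∀ i : ℕ, i < 3 * ⌊(D : ℝ) ^ τ⌋₊ →
          ‖MvPolynomial.aeval ![ξ, η] (royD^[i] P)‖ ≤ Real.exp (-(D : ℝ) ^ ν)) →
      IsAlgebraic ℚ ξ ∧ IsAlgebraic ℚ η) := fun h =>
  transcendental_exp_holds isAlgebraic_one one_ne_zero (h (cexp 1) 1 one_ne_zero
    (hyp_at_one_of_count_le _ (fun D => 3 * ⌊(D : ℝ) ^ τ⌋₊) β ν (eventually_count_le_self hτ)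
      (eventually_count_log_two_le hτβ))).1

/-- **`1 ≤ τ` is load-bearing in `RoySmallValueDirichletGap`**: the crux with `1 ≤ τ` deleted
(verbatim otherwise) is false (slice `τ = 1/2`, `β = 2`, `ν = 4`). [cite: Roy2013, p. 4] -/
theorem roySmallValueDirichletGap_false_without_oneLeTau :
    ¬ (∀ (ξ η : ℂ), η ≠ 0 → ∀ (β τ ν : ℝ), τ < 2 → τ < β → 2 + β - τ < ν →
      (∀ᶠ D : ℕ in Filter.atTop, ∃ P : MvPolynomial (Fin 2) ℤ, P ≠ 0 ∧ P.totalDegree ≤ D ∧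
        (mvPolyHeight P : ℝ) ≤ Real.exp ((D : ℝ) ^ β) ∧
        ∀ i : ℕ, i < 3 * ⌊(D : ℝ) ^ τ⌋₊ →
          ‖MvPolynomial.aeval ![ξ, η] (royD^[i] P)‖ ≤ Real.exp (-(D : ℝ) ^ ν)) →
      IsAlgebraic ℚ ξ ∧ IsAlgebraic ℚ η) := fun h =>
  roySmallValueDirichletGap_slice_false_of_tau_lt_one (τ := 1 / 2) (β := 2) (by norm_num) (by norm_num) 4
    fun ξ η hη hP => h ξ η hη 2 (1 / 2) 4 (by norm_num) (by norm_num) (by norm_num) hP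

/-- **STRENGTHENING REFUTED — any derivative count eventually `≤ D`**: the crux with Roy's count
`3⌊D^τ⌋` replaced by a count `c τ D` that is eventually `≤ D` at some admissible `τ₀ ∈ [1, 2)` is
FALSE (witness `(e, 1)`, `P_D = (X₂ − 1)^{c(D)}`, `β = τ₀ + 1`, `ν = 5 + τ₀`). [folklore] -/
theorem roySmallValueDirichletGap_false_of_count_le_degree (c : ℝ → ℕ → ℕ) {τ₀ : ℝ} (h1 : 1 ≤ τ₀)
    (h2 : τ₀ < 2) (hc : ∀ᶠ D in atTop, c τ₀ D ≤ D) :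
    ¬ (∀ (ξ η : ℂ), η ≠ 0 → ∀ (β τ ν : ℝ), 1 ≤ τ → τ < 2 → τ < β → 2 + β - τ < ν →
      (∀ᶠ D : ℕ in Filter.atTop, ∃ P : MvPolynomial (Fin 2) ℤ, P ≠ 0 ∧ P.totalDegree ≤ D ∧
        (mvPolyHeight P : ℝ) ≤ Real.exp ((D : ℝ) ^ β) ∧
        ∀ i : ℕ, i < c τ D →
          ‖MvPolynomial.aeval ![ξ, η] (royD^[i] P)‖ ≤ Real.exp (-(D : ℝ) ^ ν)) →
      IsAlgebraic ℚ ξ ∧ IsAlgebraic ℚ η) := by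
  intro h
  refine transcendental_exp_holds isAlgebraic_one one_ne_zero (h (cexp 1) 1 one_ne_zero (τ₀ + 1) τ₀
    (4 + (τ₀ + 1)) h1 h2 (by linarith) (by linarith) (hyp_at_one_of_count_le _ (c τ₀) _ _ hc ?_)).1
  filter_upwards [hc, eventually_self_log_two_le (β := τ₀ + 1) (by linarith)] with D hD hD'
  calc (c τ₀ D : ℝ) * Real.log 2 ≤ (D : ℝ) * Real.log 2 :=
        mul_le_mul_of_nonneg_right (by exact_mod_cast hD) (Real.log_nonneg one_le_two)
    _ ≤ (D : ℝ) ^ (τ₀ + 1) := hD'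

/-- **The unit-count variant (`⌊D^τ⌋` conditions instead of `3⌊D^τ⌋`) of the crux is FALSE**,
already on the slice `τ = 1`. [folklore] -/
theorem roySmallValueDirichletGap_false_with_unitCount :
    ¬ (∀ (ξ η : ℂ), η ≠ 0 → ∀ (β τ ν : ℝ), 1 ≤ τ → τ < 2 → τ < β → 2 + β - τ < ν →
      (∀ᶠ D : ℕ in Filter.atTop, ∃ P : MvPolynomial (Fin 2) ℤ, P ≠ 0 ∧ P.totalDegree ≤ D ∧
        (mvPolyHeight P : ℝ) ≤ Real.exp ((D : ℝ) ^ β) ∧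
        ∀ i : ℕ, i < ⌊(D : ℝ) ^ τ⌋₊ →
          ‖MvPolynomial.aeval ![ξ, η] (royD^[i] P)‖ ≤ Real.exp (-(D : ℝ) ^ ν)) →
      IsAlgebraic ℚ ξ ∧ IsAlgebraic ℚ η) :=
  roySmallValueDirichletGap_false_of_count_le_degree (fun τ D => ⌊(D : ℝ) ^ τ⌋₊) (τ₀ := 1) le_rfl
    (by norm_num) (Eventually.of_forall fun D => by simp)

end Summit.Schanuel.Schanuel.Theorems.RoySmallValueDirichletGapTauCount

end
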